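import Literature.AlgebraicGeometry.Motives.MotivatedCyclesProofs
import Literature.AlgebraicGeometry.Motives.CorrespondencesCompProofs
import HarnessLib

/-!
# Motivated cycles: `A_mot = A` under the standard conjecture of Lefschetz type (proofs)

`Literature.AlgebraicGeometry.Motives.MotivatedCycles` records as a named fact (D-0014)
`WeilCohomology.motivatedClasses_eq_algebraicClasses_of_lefschetzStandardConjecture` — Y. André,
*Pour une théorie inconditionnelle des motifs*, Publ. Math. IHÉS 83 (1996), §0.3 and §2.1 (the
remark following Déf. 1, p. 14): "`A_mot(X) = A(X)` si pour tout schéma `Y` dans `𝒱`, polarisé,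
l'involution de Lefschetz est donnée par une correspondance algébrique", which is the case under
Grothendieck's standard conjecture `B` of Lefschetz type (S. Kleiman, *Algebraic cycles and the Weil
conjectures* (1968), Prop. 2.3: `B(X) ⇒ ⋆` algebraic). This file **proves** it
(`motivatedClasses_eq_algebraicClasses_of_lefschetzStandardConjecture_holds`), formally in the axioms
of `Literature.AlgebraicGeometry.Motives.WeilCohomology`, on top of `CorrespondencesCompProofs`
(push-forward as the Poincaré-duality adjoint, composite correspondences), `LefschetzStarProofs` (the
explicit operator `⋆ = starOp` under hard Lefschetz and its uniqueness) and the sibling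
`MotivatedCyclesProofs` (the inclusion `A ⊆ A_mot`, André 1996 §2.1,
`algebraicClasses_le_motivatedClasses_holds`; hyperplane classes and their powers are rational
algebraic).

## The argument for `A_mot ⊆ A` under `B`

* § Induced: a linear map `Hⁱ(V) → Hʲ(V)` (`V` smooth projective of dimension `N`) is *induced by
  a rational algebraic correspondence* if in every admissible codimension some `u ∈ A(V × V)_ℚ`
  induces it in Kleiman's pairing form (`W.IsInducedBy`; spelled out in each statement, no new
  definition). This componentwise notion — weaker than `W.IsAlgebraicOperator`, which also
  constrains the operators induced in the other bidegrees and would require the Künneth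
  projectors — is all that `map_ratAlgebraicClasses_of_isInducedBy` consumes, and it is stable
  under `0`, `+`, `-`, integer multiples, composition (`isInducedBy_comp_corrComp`,
  `corrComp_mem_ratAlgebraicClasses`; the middle degree must have the right parity) and
  `x ↦ T x ∪ γ` for `γ` rational algebraic (`cup_assoc`, `map_cup`); the identity is induced by the
  diagonal (`exists_isInducedBy_id`).
* § Lefschetz: `Lˢ` is induced (its power `ηˢ` of a hyperplane class being rational algebraic);
  under `B(V, η)` in `θ`-form the inverses `(Lʳ)⁻¹` of the hard-Lefschetz isomorphisms coincide with
  the algebraic `θ`'s, so `lowerOp`, `signOp` (two-step recursion) and every component of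
  `starOp = ⋆` are induced by rational algebraic correspondences (`isRatInduced_starOp`: Kleiman
  1968 Prop. 2.3, `B ⇒ ⋆ algebraic`, in componentwise form), hence so is every `⋆`
  (`isLefschetzStar_unique`).
* § MotivatedLeAlgebraic: for a motivated `x = pr_{X*} (α ∪ ⋆β)` (`W.IsMotivatedClass`), `⋆β ∈ A_ℚ`
  (`map_ratAlgebraicClasses_of_isInducedBy`), `α ∪ ⋆β ∈ A_ℚ` (`cup_mem_ratAlgebraicClasses`), `x` is
  the push-forward `pushforward … (fst X Y) (α ∪ ⋆β)` by perfectness of the Poincaré pairing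
  (`isPerfPair_cupPairing`), and `pr_{X*}` preserves `A_ℚ` (`exists_isInducedBy_pullback`,
  `isInducedBy_transposeClass_of_adjoint`, `map_ratAlgebraicClasses_of_isInducedBy`), so
  `x ∈ A^p(X)_ℚ ⊆ K · A^p(X)`; with `algebraicClasses_le_motivatedClasses_holds` (hard Lefschetz
  being part of `B` in `θ`-form, `LefschetzStandardConjecture.hasHardLefschetz`) this gives
  `A_mot^p(X) = A^p(X)`.

No new axioms, no new definitions, no new named facts; nothing of `MotivatedCycles.lean` is
restated or modified. On the locator: the docstring of the vendored fact refers to "André 1996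
Thm 0.4"; in the paper Thm 0.4 is the theorem on the Tannakian category of motives, while the
statement `B ⇒ A_mot = A` is the remark following Déf. 1 in §2.1 (and §0.3), which is what is
proved here (as an equality of `K`-spans, exactly as vendored).

## References

* Y. André, *Pour une théorie inconditionnelle des motifs*, Publ. Math. IHÉS 83 (1996), 5–49, §0.3,
  §2.1 (Déf. 1, the remark following it, Prop. 2.1). [Andre1996Motifs]
* S. Kleiman, *Algebraic cycles and the Weil conjectures*, in: Dix exposés sur la cohomologie des
  schémas, North-Holland (1968), §1.3 (correspondences), §1.4 and Prop. 2.3 (`B ⇒ ⋆` algebraic).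
  [Kleiman1968AlgebraicCycles]
-/

universe u v

open CategoryTheory AlgebraicGeometry MonoidalCategory CartesianMonoidalCategory Opposite
open scoped TensorProduct

noncomputable section

namespace Literature.AlgebraicGeometry.Motives

namespace WeilCohomology

variable {k : Type u} [Field k] {K : Type v} [Field K] [CharZero K] (W : WeilCohomology k K)

/-! ## Operators induced by rational algebraic correspondences

Throughout, "`T : Hⁱ(V) → Hʲ(V)` is induced by a rational algebraic correspondence" (`V` smooth
projective of dimension `N`) is spelled out as: for every complementary degree `j'` (`j + j' = 2N`)
and codimension `c` with `i + 2c + j' = 4N` there is `u ∈ Aᶜ(V × V)_ℚ` inducing `T` in Kleiman's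
pairing form `tr_V (T x ∪ y) = tr_{V×V} ((pr₁* x ∪ u) ∪ pr₂* y)` (`W.IsInducedBy`; Kleiman 1968
§1.3). This componentwise notion — weaker than `W.IsAlgebraicOperator`, which also constrains the
operators induced in the other bidegrees — is what `map_ratAlgebraicClasses_of_isInducedBy` consumes. -/

section Induced

variable {N : ℕ} {V : SchemeOver k}
variable {W}

/-- The zero class induces the zero operator. [folklore] -/
lemma isInducedBy_zero {i j j' c : ℕ} (hj : j + j' = 2 * N) (hm : i + 2 * c + j' = 2 * (N + N)) :
    W.IsInducedBy N N (0 : W.obj (V ⊗ V) (2 * c)) (0 : W.obj V i →ₗ[K] W.obj V j) hj hm := by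
  intro x y
  simp only [LinearMap.zero_apply, map_zero]

/-- The zero operator is induced by a rational algebraic correspondence. [folklore] -/
lemma isRatInduced_zero {i j : ℕ} :
    ∀ (j' c : ℕ) (hj : j + j' = 2 * N) (hm : i + 2 * c + j' = 2 * (N + N)),
      ∃ u ∈ W.ratAlgebraicClasses (V ⊗ V) c,
        W.IsInducedBy N N u (0 : W.obj V i →ₗ[K] W.obj V j) hj hm :=
  fun _ _ hj hm ↦ ⟨0, zero_mem _, isInducedBy_zero hj hm⟩

/-- Sums of induced operators are induced (by the sum of the classes). [folklore] -/
lemma isRatInduced_add {i j : ℕ} {T T' : W.obj V i →ₗ[K] W.obj V j}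
    (hT : ∀ (j' c : ℕ) (hj : j + j' = 2 * N) (hm : i + 2 * c + j' = 2 * (N + N)),
      ∃ u ∈ W.ratAlgebraicClasses (V ⊗ V) c, W.IsInducedBy N N u T hj hm)
    (hT' : ∀ (j' c : ℕ) (hj : j + j' = 2 * N) (hm : i + 2 * c + j' = 2 * (N + N)),
      ∃ u ∈ W.ratAlgebraicClasses (V ⊗ V) c, W.IsInducedBy N N u T' hj hm) :
    ∀ (j' c : ℕ) (hj : j + j' = 2 * N) (hm : i + 2 * c + j' = 2 * (N + N)),
      ∃ u ∈ W.ratAlgebraicClasses (V ⊗ V) c, W.IsInducedBy N N u (T + T') hj hm := by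
  intro j' c hj hm
  obtain ⟨u, hu, hi⟩ := hT j' c hj hm
  obtain ⟨u', hu', hi'⟩ := hT' j' c hj hm
  refine ⟨u + u', add_mem hu hu', fun x y ↦ ?_⟩
  simp only [LinearMap.add_apply, map_add, hi x y, hi' x y]

/-- Differences of induced operators are induced. [folklore] -/
lemma isRatInduced_sub {i j : ℕ} {T T' : W.obj V i →ₗ[K] W.obj V j}
    (hT : ∀ (j' c : ℕ) (hj : j + j' = 2 * N) (hm : i + 2 * c + j' = 2 * (N + N)),
      ∃ u ∈ W.ratAlgebraicClasses (V ⊗ V) c, W.IsInducedBy N N u T hj hm)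
    (hT' : ∀ (j' c : ℕ) (hj : j + j' = 2 * N) (hm : i + 2 * c + j' = 2 * (N + N)),
      ∃ u ∈ W.ratAlgebraicClasses (V ⊗ V) c, W.IsInducedBy N N u T' hj hm) :
    ∀ (j' c : ℕ) (hj : j + j' = 2 * N) (hm : i + 2 * c + j' = 2 * (N + N)),
      ∃ u ∈ W.ratAlgebraicClasses (V ⊗ V) c, W.IsInducedBy N N u (T - T') hj hm := by
  intro j' c hj hm
  obtain ⟨u, hu, hi⟩ := hT j' c hj hm
  obtain ⟨u', hu', hi'⟩ := hT' j' c hj hm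
  refine ⟨u - u', sub_mem hu hu', fun x y ↦ ?_⟩
  simp only [LinearMap.sub_apply, map_sub, hi x y, hi' x y]

/-- Integer multiples (as scalars of `K`) of induced operators are induced. [folklore] -/
lemma isRatInduced_intCast_smul {i j : ℕ} {T : W.obj V i →ₗ[K] W.obj V j}
    (hT : ∀ (j' c : ℕ) (hj : j + j' = 2 * N) (hm : i + 2 * c + j' = 2 * (N + N)),
      ∃ u ∈ W.ratAlgebraicClasses (V ⊗ V) c, W.IsInducedBy N N u T hj hm) (z : ℤ) :
    ∀ (j' c : ℕ) (hj : j + j' = 2 * N) (hm : i + 2 * c + j' = 2 * (N + N)),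
      ∃ u ∈ W.ratAlgebraicClasses (V ⊗ V) c, W.IsInducedBy N N u (((z : ℤ) : K) • T) hj hm := by
  intro j' c hj hm
  obtain ⟨u, hu, hi⟩ := hT j' c hj hm
  refine ⟨z • u, AddSubgroup.zsmul_mem _ hu z, fun x y ↦ ?_⟩
  rw [← Int.cast_smul_eq_zsmul K z u]
  simp only [LinearMap.smul_apply, map_smul, hi x y]

/-- **Composites of induced operators are induced** (Kleiman 1968 §1.3; the composite class
`v ∘ u = p₁₃₊ (p₁₂* u ∪ p₂₃* v)` of `CorrespondencesCompProofs`, rational algebraic by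
`corrComp_mem_ratAlgebraicClasses`). The middle degree `m` must have the parity of `i`. [cite: Kleiman1968AlgebraicCycles, §1.3] -/
lemma isRatInduced_comp (hV : IsSmoothProjective N V) {i m j : ℕ} {T : W.obj V i →ₗ[K] W.obj V m}
    {S : W.obj V m →ₗ[K] W.obj V j}
    (hS : ∀ (j' c : ℕ) (hj : j + j' = 2 * N) (hm : m + 2 * c + j' = 2 * (N + N)),
      ∃ u ∈ W.ratAlgebraicClasses (V ⊗ V) c, W.IsInducedBy N N u S hj hm)
    (hT : ∀ (m' c : ℕ) (hj : m + m' = 2 * N) (hm : i + 2 * c + m' = 2 * (N + N)),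
      ∃ u ∈ W.ratAlgebraicClasses (V ⊗ V) c, W.IsInducedBy N N u T hj hm)
    (hpar : 2 ∣ i + m) :
    ∀ (j' c : ℕ) (hj : j + j' = 2 * N) (hm : i + 2 * c + j' = 2 * (N + N)),
      ∃ u ∈ W.ratAlgebraicClasses (V ⊗ V) c, W.IsInducedBy N N u (S ∘ₗ T) hj hm := by
  intro j' c hj hm
  by_cases hm2 : 2 * N < m
  · haveI := W.subsingleton_obj hV hm2
    refine ⟨0, zero_mem _, fun x y ↦ ?_⟩
    simp only [LinearMap.comp_apply, Subsingleton.elim (T x) 0, map_zero, LinearMap.zero_apply]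
  by_cases hi2 : 2 * N < i
  · haveI := W.subsingleton_obj hV hi2
    refine ⟨0, zero_mem _, fun x y ↦ ?_⟩
    rw [Subsingleton.elim x 0]
    simp only [map_zero, LinearMap.zero_apply]
  obtain ⟨m', hm'⟩ : ∃ m', m + m' = 2 * N := ⟨2 * N - m, by omega⟩
  obtain ⟨a, ha⟩ : ∃ a, i + 2 * a + m' = 2 * (N + N) := ⟨(2 * N + m - i) / 2, by omega⟩
  obtain ⟨b, hb⟩ : ∃ b, m + 2 * b + j' = 2 * (N + N) := ⟨(2 * N + j - m) / 2, by omega⟩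
  obtain ⟨u, hu, hiu⟩ := hT m' a hm' ha
  obtain ⟨v, hv, hiv⟩ := hS j' b hj hb
  have hc : a + b = c + N := by omega
  have hd : 2 * c + (i + j') = 2 * (N + N) := by omega
  exact ⟨W.corrComp hV hV u v hc hd, W.corrComp_mem_ratAlgebraicClasses hV hV hV hu hv hc hd,
    W.isInducedBy_comp_corrComp hV hV hV hiu hiv hc hd hm⟩

/-- The identity of `Hⁱ(V)` is induced by the (rational algebraic) class of the diagonal (axiom
`exists_isInducedBy_id`). [cite: Kleiman1968AlgebraicCycles, §1.3] -/
lemma isRatInduced_id (hV : IsSmoothProjective N V) (i : ℕ) :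
    ∀ (j' c : ℕ) (hj : i + j' = 2 * N) (hm : i + 2 * c + j' = 2 * (N + N)),
      ∃ u ∈ W.ratAlgebraicClasses (V ⊗ V) c,
        W.IsInducedBy N N u (LinearMap.id : W.obj V i →ₗ[K] W.obj V i) hj hm := by
  intro j' c hj hm
  obtain ⟨u, hu, hi⟩ := W.exists_isInducedBy_id hV
  obtain rfl : c = N := by omega
  exact ⟨u, hu, hi i j' hj⟩

/-- An operator that is algebraic in the strong sense `W.IsAlgebraicOperator` is induced by a
rational algebraic correspondence. [folklore] -/
lemma isRatInduced_of_isAlgebraicOperator {i j : ℕ} {T : W.obj V i →ₗ[K] W.obj V j}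
    (hT : W.IsAlgebraicOperator N N T) :
    ∀ (j' c : ℕ) (hj : j + j' = 2 * N) (hm : i + 2 * c + j' = 2 * (N + N)),
      ∃ u ∈ W.ratAlgebraicClasses (V ⊗ V) c, W.IsInducedBy N N u T hj hm := by
  intro j' c hj hm
  obtain ⟨u, hu, -⟩ := hT
  refine ⟨u c, (u c).2, ?_⟩
  have := hu i j c j' hj hm (by omega)
  rwa [PreWeilCohomology.GradedOp.ofLinearMap_apply_same] at this

/-- **Cup product on the right with an algebraic class preserves inducedness**: if `T` is induced
by `u` then `x ↦ T x ∪ γ` (`γ ∈ Aˢ(V)_ℚ`) is induced by `u ∪ pr₂* γ` (`cup_assoc`, `map_cup`;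
Kleiman 1968 §1.3, the correspondence `δ₊ γ`). [cite: Kleiman1968AlgebraicCycles, §1.3] -/
lemma isRatInduced_cup_right (hV : IsSmoothProjective N V) {i j s l : ℕ}
    {T : W.obj V i →ₗ[K] W.obj V j}
    (hT : ∀ (j' c : ℕ) (hj : j + j' = 2 * N) (hm : i + 2 * c + j' = 2 * (N + N)),
      ∃ u ∈ W.ratAlgebraicClasses (V ⊗ V) c, W.IsInducedBy N N u T hj hm)
    {γ : W.obj V (2 * s)} (hγ : γ ∈ W.ratAlgebraicClasses V s) (h : j + 2 * s = l) :
    ∀ (l' c : ℕ) (hl : l + l' = 2 * N) (hm : i + 2 * c + l' = 2 * (N + N)),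
      ∃ u ∈ W.ratAlgebraicClasses (V ⊗ V) c,
        W.IsInducedBy N N u ((W.cup h).flip γ ∘ₗ T) hl hm := by
  have hVV := IsSmoothProjective.tensor_holds hV hV
  intro l' c hl hm
  by_cases hi2 : 2 * N < i
  · haveI := W.subsingleton_obj hV hi2
    refine ⟨0, zero_mem _, fun x y ↦ ?_⟩
    rw [Subsingleton.elim x 0]
    simp only [map_zero, LinearMap.zero_apply]
  obtain ⟨c₀, hc₀⟩ : ∃ c₀, c₀ + s = c := ⟨c - s, by omega⟩
  have hj : j + (2 * s + l') = 2 * N := by omega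
  have hm₀ : i + 2 * c₀ + (2 * s + l') = 2 * (N + N) := by omega
  obtain ⟨u, hu, hiu⟩ := hT (2 * s + l') c₀ hj hm₀
  have h2 : 2 * c₀ + 2 * s = 2 * c := by omega
  refine ⟨W.cup h2 u (W.pullback (snd V V) (2 * s) γ),
    W.cup_mem_ratAlgebraicClasses hVV hc₀ _ _ hu
      (W.pullback_ratAlgebraicClasses_le hVV hV (snd V V) s ⟨γ, hγ, rfl⟩), fun x y ↦ ?_⟩
  simp only [LinearMap.comp_apply, LinearMap.flip_apply]
  rw [W.cup_assoc hV h rfl hl hj (T x) γ y, hiu x (W.cup rfl γ y),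
    W.map_cup hVV hV (snd V V) rfl γ y,
    ← W.cup_assoc hVV (show i + 2 * c₀ + 2 * s = i + 2 * c by omega) rfl hm hm₀,
    W.cup_assoc hVV rfl h2 (show i + 2 * c₀ + 2 * s = i + 2 * c by omega) rfl]

end Induced

/-! ## Hyperplane classes are algebraic; the Lefschetz operators are induced -/

section Lefschetz

variable {N : ℕ} {V : SchemeOver k} {η : W.obj V 2}
variable {W}

/-- **The iterated Lefschetz operator `Lˢ = (· ∪ ηˢ) : Hⁱ(V) → Hⁱ⁺²ˢ(V)` is induced by a rational
algebraic correspondence** (the class `Δ₊ ηˢ = u_Δ ∪ pr₂* ηˢ`; Kleiman 1968 §1.3–1.4), for `η` a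
rational algebraic class (e.g. a hyperplane class). [cite: Kleiman1968AlgebraicCycles, §1.4] -/
lemma isRatInduced_lefschetzPow (hV : IsSmoothProjective N V) (hη : η ∈ W.ratAlgebraicClasses V 1)
    (s i j : ℕ) (h : i + 2 * s = j) :
    ∀ (j' c : ℕ) (hj : j + j' = 2 * N) (hm : i + 2 * c + j' = 2 * (N + N)),
      ∃ u ∈ W.ratAlgebraicClasses (V ⊗ V) c,
        W.IsInducedBy N N u (W.lefschetzPow V η s i j h) hj hm := by
  cases s with
  | zero =>
    obtain rfl : i = j := by omega
    have : W.lefschetzPow V η 0 i i h = LinearMap.id :=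
      LinearMap.ext fun x ↦ W.lefschetzPow_zero_apply hV η h x
    rw [this]
    exact isRatInduced_id hV i
  | succ r =>
    have : W.lefschetzPow V η (r + 1) i j h = (W.cup h).flip (W.pow V η (r + 1)) ∘ₗ LinearMap.id :=
      rfl
    rw [this]
    exact isRatInduced_cup_right hV (isRatInduced_id hV i)
      (W.pow_succ_mem_ratAlgebraicClasses hV hη r) h

/-- Under `B(V, η)` (in `θ`-form), the inverse `(Lʳ)⁻¹ : H²ᴺ⁻ⁱ(V) → Hⁱ(V)` of a hard-Lefschetz
isomorphism is induced by a rational algebraic correspondence: it coincides with the algebraic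
operator `θ` of `B(V, η)` (two-sided inverses are unique). [cite: Kleiman1968AlgebraicCycles, §2 (conjecture B(X), θ-form)] -/
lemma isRatInduced_hardLefschetzEquiv_symm (hB : W.StandardConjectureB N V η)
    (hL : W.HasHardLefschetz) (hV : IsSmoothProjective N V) (hη : W.IsHyperplaneClass V η)
    {i r j : ℕ} (hr : i + r = N) (h : i + 2 * r = j) :
    ∀ (j' c : ℕ) (hj : i + j' = 2 * N) (hm : j + 2 * c + j' = 2 * (N + N)),
      ∃ u ∈ W.ratAlgebraicClasses (V ⊗ V) c,
        W.IsInducedBy N N u (W.hardLefschetzEquiv hL hV hη i r j hr h).symm.toLinearMap hj hm := by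
  obtain ⟨θ, ⟨-, -, hθ⟩, halg⟩ := hB i r j hr h
  have heq : (W.hardLefschetzEquiv hL hV hη i r j hr h).symm.toLinearMap = θ := by
    refine LinearMap.ext fun y ↦ (W.hardLefschetzEquiv hL hV hη i r j hr h).injective ?_
    rw [LinearEquiv.coe_coe, LinearEquiv.apply_symm_apply, hardLefschetzEquiv_apply,
      ← LinearMap.comp_apply, hθ, LinearMap.id_apply]
  rw [heq]
  exact isRatInduced_of_isAlgebraicOperator halg

/-- Under `B(V, η)`, the operator `lowerOp = (Lʳ⁺²)⁻¹ ∘ Lʳ⁺¹ : Hᵐ⁺²(V) → Hᵐ(V)` of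
`LefschetzStarProofs` is induced by a rational algebraic correspondence. [folklore] -/
lemma isRatInduced_lowerOp (hB : W.StandardConjectureB N V η) (hL : W.HasHardLefschetz)
    (hV : IsSmoothProjective N V) (hη : W.IsHyperplaneClass V η) (m r : ℕ) (hr : m + 2 + r = N) :
    ∀ (j' c : ℕ) (hj : m + j' = 2 * N) (hm : m + 2 + 2 * c + j' = 2 * (N + N)),
      ∃ u ∈ W.ratAlgebraicClasses (V ⊗ V) c,
        W.IsInducedBy N N u (W.lowerOp hL hV hη m r hr) hj hm :=
  isRatInduced_comp hV (isRatInduced_hardLefschetzEquiv_symm hB hL hV hη _ rfl)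
    (isRatInduced_lefschetzPow hV (W.mem_ratAlgebraicClasses_of_isHyperplaneClass hV hη) _ _ _ _)
    ⟨m + r + 3, by omega⟩

/-- Under `B(V, η)`, the sign operator `signOp` of `LefschetzStarProofs` (acting by Kleiman's sign
`(-1)^{i(i+1)/2}` on the Lefschetz summand `Lʲ Pⁱ(V)`) is induced by a rational algebraic
correspondence: it is built from `id`, `L`, `lowerOp` by sums, integer multiples and composites
(two-step recursion on the degree). [cite: Kleiman1968AlgebraicCycles, Prop. 2.3] -/
lemma isRatInduced_signOp (hB : W.StandardConjectureB N V η) (hL : W.HasHardLefschetz)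
    (hV : IsSmoothProjective N V) (hη : W.IsHyperplaneClass V η) :
    ∀ (a r : ℕ) (hr : a + r = N) (j' c : ℕ) (hj : a + j' = 2 * N)
      (hm : a + 2 * c + j' = 2 * (N + N)),
      ∃ u ∈ W.ratAlgebraicClasses (V ⊗ V) c,
        W.IsInducedBy N N u (W.signOp hL hV hη a r hr) hj hm
  | 0, _, _ => by
    rw [signOp]
    exact isRatInduced_intCast_smul (isRatInduced_id hV 0) _
  | 1, _, _ => by
    rw [signOp]
    exact isRatInduced_intCast_smul (isRatInduced_id hV 1) _
  | m + 2, r, hr => by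
    rw [signOp]
    have hη' := W.mem_ratAlgebraicClasses_of_isHyperplaneClass hV hη
    have hlow := isRatInduced_lowerOp hB hL hV hη m r hr
    have hLop := isRatInduced_lefschetzPow hV hη' 1 m (m + 2) (by omega)
    exact isRatInduced_add
      (isRatInduced_intCast_smul (isRatInduced_sub (isRatInduced_id hV (m + 2))
        (isRatInduced_comp hV hLop hlow ⟨m + 1, by omega⟩)) _)
      (isRatInduced_comp hV hLop (isRatInduced_comp hV (isRatInduced_signOp hB hL hV hη m (r + 2) _)
        hlow ⟨m + 1, by omega⟩) ⟨m + 1, by omega⟩)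

/-- **Under `B(V, η)` every component of Kleiman's `⋆` is induced by a rational algebraic
correspondence** (Kleiman 1968 Prop. 2.3, `B(X) ⇒ ⋆ algebraic`, in the componentwise form;
Kleiman 1994 Thm 4-1): `⋆|_{Hᵃ} = Lᴺ⁻ᵃ ∘ signOp` for `a ≤ N` and `signOp ∘ (Lᵃ⁻ᴺ)⁻¹` for
`N < a ≤ 2N` (`starOp` of `LefschetzStarProofs`), and `L`, the `θ`'s and the signs are induced by
rational algebraic correspondences. [cite: Kleiman1968AlgebraicCycles, Prop. 2.3] -/
theorem isRatInduced_starOp (hB : W.StandardConjectureB N V η) (hL : W.HasHardLefschetz)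
    (hV : IsSmoothProjective N V) (hη : W.IsHyperplaneClass V η) (a b : ℕ) :
    ∀ (j' c : ℕ) (hj : b + j' = 2 * N) (hm : a + 2 * c + j' = 2 * (N + N)),
      ∃ u ∈ W.ratAlgebraicClasses (V ⊗ V) c,
        W.IsInducedBy N N u (W.starOp hL hV hη a b) hj hm := by
  unfold starOp
  split_ifs with hab ha
  · exact isRatInduced_comp hV
      (isRatInduced_lefschetzPow hV (W.mem_ratAlgebraicClasses_of_isHyperplaneClass hV hη) _ _ _ _)
      (isRatInduced_signOp hB hL hV hη a (N - a) _) ⟨a, by omega⟩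
  · exact isRatInduced_comp hV (isRatInduced_signOp hB hL hV hη b (N - b) _)
      (isRatInduced_hardLefschetzEquiv_symm hB hL hV hη _ _) ⟨N, by omega⟩
  · exact isRatInduced_zero

/-- Under `B(V, η)` and hard Lefschetz, every Lefschetz star operator `⋆` of `(V, η)` (any `S` with
`W.IsLefschetzStar N η S`; it is unique, `isLefschetzStar_unique`) has all its components induced
by rational algebraic correspondences. [cite: Kleiman1968AlgebraicCycles, Prop. 2.3] -/
theorem isRatInduced_of_isLefschetzStar (hB : W.StandardConjectureB N V η)
    (hL : W.HasHardLefschetz) (hV : IsSmoothProjective N V) (hη : W.IsHyperplaneClass V η)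
    {S : W.GradedOp V V} (hS : W.IsLefschetzStar N η S) (a b : ℕ) :
    ∀ (j' c : ℕ) (hj : b + j' = 2 * N) (hm : a + 2 * c + j' = 2 * (N + N)),
      ∃ u ∈ W.ratAlgebraicClasses (V ⊗ V) c, W.IsInducedBy N N u (S a b) hj hm := by
  rw [W.isLefschetzStar_unique hL hV hη hS (W.isLefschetzStar_starOp hL hV hη)]
  exact isRatInduced_starOp hB hL hV hη a b

end Lefschetz

/-! ## Motivated classes are algebraic under `B` -/

section MotivatedLeAlgebraic

variable {n m : ℕ} {X Y : SchemeOver k}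
variable {W}

/-- **The push-forward `pr_{X*} : H^{2(p+m)}(X × Y) → H^{2p}(X)` preserves rational algebraic
classes**: `pr_X*` is induced by the rational algebraic class of the transposed graph
(`exists_isInducedBy_pullback`), so its Poincaré-duality adjoint `pr_{X*}` (`pushforward`) is induced
by the transpose of that class (`isInducedBy_transposeClass_of_adjoint`) and preserves `A_ℚ`
(`map_ratAlgebraicClasses_of_isInducedBy`); cf. `corrComp_mem_ratAlgebraicClasses`.
[cite: Kleiman1968AlgebraicCycles, §1.3] -/
lemma pushforward_fst_mem_ratAlgebraicClasses (hX : IsSmoothProjective n X)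
    (hY : IsSmoothProjective m Y) {p q : ℕ} (he : 2 * (p + m) + 2 * q = 2 * (n + m))
    (hd : 2 * p + 2 * q = 2 * n) {z : W.obj (X ⊗ Y) (2 * (p + m))}
    (hz : z ∈ W.ratAlgebraicClasses (X ⊗ Y) (p + m)) :
    W.pushforward (N := n + m) hX (fst X Y) he hd z ∈ W.ratAlgebraicClasses X p := by
  have hXY := IsSmoothProjective.tensor_holds hX hY
  obtain ⟨γ, hγ, hγi⟩ := W.exists_isInducedBy_pullback hXY hX (fst X Y)
  have hind : W.IsInducedBy (n + m) n (W.transposeClass γ)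
      (W.pushforward (N := n + m) hX (fst X Y) he hd) hd
      (show 2 * (p + m) + 2 * n + 2 * q = 2 * (n + m + n) by omega) := by
    refine W.isInducedBy_transposeClass_of_adjoint hX hXY (hγi (2 * q) (2 * (p + m)) (by omega))
      (by omega : 2 * q + 2 * p = 2 * n) ?_ hd _
    intro y w
    change W.trace _ _ (W.cup _ (W.pullback (fst X Y) (2 * q) y) w) =
      W.trace _ _ (W.cup _ y (W.pushforward hX (fst X Y) he hd w))
    rw [W.cup_comm_of_even hXY _ he (Or.inl ⟨q, two_mul q⟩),
      W.cup_comm_of_even hX _ hd (Or.inl ⟨q, two_mul q⟩), W.trace_cup_pushforward]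
  exact W.map_ratAlgebraicClasses_of_isInducedBy hXY hX (W.transposeClass γ) _ hd _
    (W.pullback_ratAlgebraicClasses_le (IsSmoothProjective.tensor_holds hXY hX)
      (IsSmoothProjective.tensor_holds hX hXY) (β_ _ _).hom n ⟨γ, hγ, rfl⟩) hind z hz

/-- **Motivated classes are algebraic under `B`** (André 1996 §2.1, remark following Déf. 1:
`A_mot(X) = A(X)` as soon as the Lefschetz involutions of the polarised `X × Y` are algebraic;
Kleiman 1968 Prop. 2.3 for `B ⇒ ⋆ algebraic`): if the standard conjecture of Lefschetz type holds
for `W`, every motivated class `x = pr_{X*} (α ∪ ⋆β)` lies in `A^p(X)_ℚ`. Indeed `⋆β` is rational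
algebraic (`isRatInduced_of_isLefschetzStar`, `map_ratAlgebraicClasses_of_isInducedBy`), hence so is
`α ∪ ⋆β` (`cup_mem_ratAlgebraicClasses`), `x` is the push-forward `pr_{X*} (α ∪ ⋆β)` by perfectness of
the Poincaré pairing (`isPerfPair_cupPairing`), and `pr_{X*}` preserves rational algebraic classes
(`pushforward_fst_mem_ratAlgebraicClasses`). [cite: Andre1996Motifs, §2.1 (remark following Déf. 1)] -/
theorem mem_ratAlgebraicClasses_of_isMotivatedClass (hB : W.LefschetzStandardConjecture)
    (hX : IsSmoothProjective n X) {p : ℕ} {x : W.obj X (2 * p)}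
    (hx : W.IsMotivatedClass n X p x) : x ∈ W.ratAlgebraicClasses X p := by
  have hL := hB.hasHardLefschetz
  obtain ⟨m, Y, hY, η, hη, S, hS, a, b, b', hbb', hab, α, β, hα, hβ, hproj⟩ := hx
  have hXY := IsSmoothProjective.tensor_holds hX hY
  -- `⋆β` is rational algebraic
  have hSβ : S (2 * b) (2 * b') β ∈ W.ratAlgebraicClasses (X ⊗ Y) b' := by
    obtain ⟨u, hu, hind⟩ := isRatInduced_of_isLefschetzStar (hB hXY η hη) hL hXY hη hS (2 * b)
      (2 * b') (2 * b) (2 * b') (by omega) (by omega)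
    exact W.map_ratAlgebraicClasses_of_isInducedBy hXY hXY u _ _ _ hu hind β hβ
  -- hence so is `z = α ∪ ⋆β`
  have hz : W.cup (show 2 * a + 2 * b' = 2 * (p + m) by omega) α (S (2 * b) (2 * b') β) ∈
      W.ratAlgebraicClasses (X ⊗ Y) (p + m) :=
    W.cup_mem_ratAlgebraicClasses hXY (by omega) _ _ hα hSβ
  -- above the top degree there is nothing to prove
  by_cases hp : n < p
  · haveI := W.subsingleton_obj hX (i := 2 * p) (by omega)
    rw [Subsingleton.elim x 0]
    exact zero_mem _
  obtain ⟨q, hq⟩ : ∃ q, p + q = n := ⟨n - p, by omega⟩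
  have he : 2 * (p + m) + 2 * q = 2 * (n + m) := by omega
  have hd : 2 * p + 2 * q = 2 * n := by omega
  -- `x` is the push-forward of `z`
  have hxz : x = W.pushforward (N := n + m) hX (fst X Y) he hd
      (W.cup (show 2 * a + 2 * b' = 2 * (p + m) by omega) α (S (2 * b) (2 * b') β)) := by
    haveI := W.isPerfPair_cupPairing hX (2 * p) (2 * q) hd
    refine (LinearMap.IsPerfPair.bijective_left (W.cupPairing X n (2 * p) (2 * q) hd)).1 ?_
    ext y
    rw [hproj q hq y, PreWeilCohomology.cupPairing, LinearMap.compr₂_apply, W.trace_cup_pushforward]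
  rw [hxz]
  exact pushforward_fst_mem_ratAlgebraicClasses hX hY he hd hz

/-- Under `B`, the span of the motivated classes is contained in the span of the algebraic
classes: `A_mot^p(X) ≤ A^p(X)` as `K`-subspaces of `H²ᵖ(X)`. [cite: Andre1996Motifs, §2.1 (remark following Déf. 1)] -/
theorem motivatedClasses_le_algebraicClasses (hB : W.LefschetzStandardConjecture)
    (hX : IsSmoothProjective n X) (p : ℕ) : W.motivatedClasses n X p ≤ W.algebraicClasses X p :=
  Submodule.span_le.mpr fun _ hx ↦
    W.ratAlgebraicClasses_le_algebraicClasses X p (mem_ratAlgebraicClasses_of_isMotivatedClass hB hX hx)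

end MotivatedLeAlgebraic

/-! ## The discharge -/

section Discharge

/-- **André's theorem `B ⇒ A_mot = A`**, discharge of the named fact
`motivatedClasses_eq_algebraicClasses_of_lefschetzStandardConjecture` (André 1996, §0.3 and §2.1,
remark following Déf. 1: the motivated classes reduce to the algebraic ones as soon as the Lefschetz
involutions `⋆` of the polarised auxiliary products are given by algebraic correspondences, which is
the case under Grothendieck's standard conjecture of Lefschetz type by Kleiman 1968 Prop. 2.3): if
`B` holds for `W` then `A_mot^p(X) = A^p(X)` (as `K`-subspaces of `H²ᵖ(X)`) for every smooth
projective `X`. The inclusion `⊆` is `motivatedClasses_le_algebraicClasses`; `⊇` is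
`algebraicClasses_le_motivatedClasses_holds` with hard Lefschetz supplied by `B`
(`LefschetzStandardConjecture.hasHardLefschetz`). [cite: Andre1996Motifs, §2.1 (remark following Déf. 1) and §0.3] -/
theorem motivatedClasses_eq_algebraicClasses_of_lefschetzStandardConjecture_holds :
    W.motivatedClasses_eq_algebraicClasses_of_lefschetzStandardConjecture :=
  fun hB _ _ hX p ↦ le_antisymm (motivatedClasses_le_algebraicClasses hB hX p)
    (W.algebraicClasses_le_motivatedClasses_holds hB.hasHardLefschetz hX p)

end Discharge

end WeilCohomology

end Literature.AlgebraicGeometry.Motives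

end
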